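import Summits.AtomisticToContinuum.FouriersLaw.Theses.PhononMeanFreePath
import Summits.AtomisticToContinuum.FouriersLaw.Theorems.BoundaryKubo.Negative.LoadBearing
import Literature.MathematicalPhysics.KineticTheory.LangevinChainLocalMinorization

/-!
# Uniform local minorisation at time one, helper 1: local uniformity in the bath temperatures
(helper for stub `stub_uniformLocalMinorization` of line `gibbs-ttcf`, crux stmt-AtomisticToContinuum-11812
`PhononMeanFreePath.BoundaryKubo`)

`pinnedChain_minorization_at_one` (`LangevinChainLocalMinorization.lean`) proves, for ONE pair of bath
temperatures, `P_1(z, T) ≥ c · Leb(T)` for measurable `T ⊆ B(0, r)` and `‖z‖ < ε₁`, by a submersion of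
the dyadic noise skeleton (`exists_measure_preimage_ge_of_surjective`, uniform in an abstract parameter).
Here the same proof is re-run with the skeleton objects built at UNIT noise amplitudes and the bath
temperatures `(a, b)` put INTO the parameter of the submersion lemma: the amplitudes
`(√(2γa), √(2γb))` enter the forcing linearly (`plInterp_smul`), so with the unit-amplitude solution
family `S₁` one has `Φ^{a,b}_1(z, PL(x) + r) = S₁(z, (√(2γa) x¹, √(2γb) x²), ρ_r)(1)`; the map
`f ((z, ρ), (a, b)) y = S₁(z, (√(2γa) y¹, √(2γb) y²), ρ)(1)` is `C¹` in `y` with a differential continuous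
in all variables and onto at `((0, 0), (a₀, b₀))`, `y = 0` (`a₀, b₀ > 0`). The submersion estimate is then
uniform for `(z, ρ, a, b)` near `(0, 0, a₀, b₀)`, and the probabilistic assembly of the tree proof goes
through verbatim:

* `uniformLocalMinorization_local` (registered sub-goal) — for `a₀, b₀ > 0` there are `ε₁, r, c > 0` with
  `P^{a,b}_1(z, T) ≥ c · Leb(T)` for all `|a - a₀|, |b - b₀| < ε₁`, `‖z‖ < ε₁`, measurable `T ⊆ B(0, r)`.
-/

noncomputable section

open scoped NNReal ENNReal Topology
open MeasureTheory Filter Set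

namespace Summit.AtomisticToContinuum.FouriersLaw.Theorems.BoundaryKubo.GibbsTtcf

open Literature.MathematicalPhysics.KineticTheory.HeatConduction
open Literature.Probability.Process Literature.Analysis.ODE Literature.Analysis.Calculus OscillatorChain
open ProbabilityTheory Metric Function unitInterval

set_option maxHeartbeats 1600000 in
/-- **Local minorisation of the pinned chain at time one, near the equilibrium, locally uniformly in
the bath temperatures**: for `a₀, b₀ > 0` there are `ε₁, r > 0` and `c > 0` such that
`P^{a,b}_1(z, T) ≥ c · Leb(T)` for every measurable `T ⊆ B(0, r)`, every initial condition `‖z‖ < ε₁`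
and all bath temperatures `|a - a₀| < ε₁`, `|b - b₀| < ε₁`.
[cite: CuneoEckmannHairerReyBellet2018, Prop 3.6 (proof)] -/
theorem uniformLocalMinorization_local :
    ∀ ω₂ lam β γ : ℝ, 0 < ω₂ → 0 < lam → 0 < β → 0 < γ → ∀ (N : ℕ) (a₀ b₀ : ℝ), 0 < a₀ → 0 < b₀ →
      ∃ ε₁ : ℝ, 0 < ε₁ ∧ ∃ r : ℝ, 0 < r ∧ ∃ c : ℝ≥0∞, 0 < c ∧
        ∀ a b : ℝ, |a - a₀| < ε₁ → |b - b₀| < ε₁ →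
          ∀ z : PhaseSpace (N + 1), ‖z‖ < ε₁ →
            ∀ S ⊆ Metric.ball (0 : PhaseSpace (N + 1)) r, MeasurableSet S →
              c * volume S ≤ (pinnedChain ω₂ lam β γ).transitionKernel (N + 1) a b 1 z S := by
  intro ω₂ lam β γ hω hl hβ hγ N a₀ b₀ ha₀ hb₀
  classical
  have hN : 0 < N + 1 := Nat.succ_pos N
  -- the level `m` and the skeleton objects at UNIT amplitudes
  obtain ⟨m, hm⟩ := pinnedChain_exists_skeleton_level_surjective (ω₂ := ω₂) (lam := lam) (β := β)
    (γ := γ) hω hl.le hβ.le hγ.le hN one_ne_zero 1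
  let η : PairSkeleton m → C(I, Fin (N + 1) → ℝ) → ℝ → Fin (N + 1) → ℝ := fun x ρ t i =>
    ρ (projIcc 0 1 zero_le_one t) i +
      ((if i.val = 0 then (1 : ℝ) else 0) * plInterp m x.1 t.toNNReal +
        (if i.val = N + 1 - 1 then (1 : ℝ) else 0) * plInterp m x.2 t.toNNReal)
  have hη : ∀ (x : PairSkeleton m) (ρ : C(I, Fin (N + 1) → ℝ)) (t : ℝ) (i : Fin (N + 1)),
      η x ρ t i = ρ (projIcc 0 1 zero_le_one t) i +
        ((if i.val = 0 then (1 : ℝ) else 0) * plInterp m x.1 t.toNNReal +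
          (if i.val = N + 1 - 1 then (1 : ℝ) else 0) * plInterp m x.2 t.toNNReal) := fun _ _ _ _ => rfl
  obtain ⟨g, hg⟩ := exists_skelForcingCLM m 1 1 η hη
  obtain ⟨S, hSapply, hS, huniq, hdiff⟩ := exists_skelSol hω hl.le hβ.le hγ.le m 1 1 η hη g hg 1 le_rfl
  have hS0 : S 0 = 0 := skelSol_zero hω hl.le hβ.le hγ.le m 1 1 η hη hSapply
  have hsurjT := hm η hη g hg S hS huniq
  -- the scaling of the skeleton by the amplitudes `(√(2γa), √(2γb))`
  let E₁ : PairSkeleton m →L[ℝ] PairSkeleton m :=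
    (ContinuousLinearMap.inl ℝ (Fin (2 ^ m) → ℝ) (Fin (2 ^ m) → ℝ)).comp
      (ContinuousLinearMap.fst ℝ (Fin (2 ^ m) → ℝ) (Fin (2 ^ m) → ℝ))
  let E₂ : PairSkeleton m →L[ℝ] PairSkeleton m :=
    (ContinuousLinearMap.inr ℝ (Fin (2 ^ m) → ℝ) (Fin (2 ^ m) → ℝ)).comp
      (ContinuousLinearMap.snd ℝ (Fin (2 ^ m) → ℝ) (Fin (2 ^ m) → ℝ))
  let D : ℝ × ℝ → PairSkeleton m →L[ℝ] PairSkeleton m := fun q =>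
    Real.sqrt (2 * γ * q.1) • E₁ + Real.sqrt (2 * γ * q.2) • E₂
  have hD : ∀ (q : ℝ × ℝ) (y : PairSkeleton m),
      D q y = (Real.sqrt (2 * γ * q.1) • y.1, Real.sqrt (2 * γ * q.2) • y.2) := by
    intro q y
    simp [D, E₁, E₂]
  have hDc : Continuous D := by
    have h1 : Continuous fun q : ℝ × ℝ => Real.sqrt (2 * γ * q.1) := by fun_prop
    have h2 : Continuous fun q : ℝ × ℝ => Real.sqrt (2 * γ * q.2) := by fun_prop
    exact (h1.smul continuous_const).add (h2.smul continuous_const)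
  -- the map `f ((z, ρ), (a, b)) y = S (z, D (a, b) y, ρ) 1` and its partial differential in `y`
  let ι : PairSkeleton m →L[ℝ] PhaseSpace (N + 1) × PairSkeleton m × C(I, Fin (N + 1) → ℝ) :=
    (ContinuousLinearMap.inr ℝ (PhaseSpace (N + 1)) (PairSkeleton m × C(I, Fin (N + 1) → ℝ))).comp
      (ContinuousLinearMap.inl ℝ (PairSkeleton m) C(I, Fin (N + 1) → ℝ))
  have hι : ∀ x : PairSkeleton m, ι x = ((0 : PhaseSpace (N + 1)), x, (0 : C(I, Fin (N + 1) → ℝ))) :=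
    fun x => rfl
  let f : (PhaseSpace (N + 1) × C(I, Fin (N + 1) → ℝ)) × (ℝ × ℝ) → PairSkeleton m → PhaseSpace (N + 1) :=
    fun p y => S (p.1.1, D p.2 y, p.1.2) 1
  let f' : (PhaseSpace (N + 1) × C(I, Fin (N + 1) → ℝ)) × (ℝ × ℝ) → PairSkeleton m →
      PairSkeleton m →L[ℝ] PhaseSpace (N + 1) :=
    fun p y => (ContinuousMap.evalCLM ℝ (1 : I)).comp ((fderiv ℝ S (p.1.1, D p.2 y, p.1.2)).comp (ι.comp (D p.2)))
  have hSd : Differentiable ℝ S := hdiff.differentiable one_ne_zero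
  have hf' : ∀ p y, HasFDerivAt (f p) (f' p y) y := by
    intro p y
    have hA : HasFDerivAt (fun y : PairSkeleton m => (p.1.1, D p.2 y, p.1.2)) (ι.comp (D p.2)) y := by
      have h1 : (fun y : PairSkeleton m => (p.1.1, D p.2 y, p.1.2)) = fun y => ι (D p.2 y) + (p.1.1, 0, p.1.2) := by
        funext y; rw [hι]; simp
      rw [h1]
      exact (ι.comp (D p.2)).hasFDerivAt.add_const _
    have hSx := (hSd (p.1.1, D p.2 y, p.1.2)).hasFDerivAt.comp y hA
    exact (ContinuousMap.evalCLM ℝ (1 : I)).hasFDerivAt.comp y hSx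
  have hinner_c : Continuous fun q : ((PhaseSpace (N + 1) × C(I, Fin (N + 1) → ℝ)) × (ℝ × ℝ)) × PairSkeleton m =>
      (q.1.1.1, D q.1.2 q.2, q.1.1.2) := by
    have hDq : Continuous fun q : ((PhaseSpace (N + 1) × C(I, Fin (N + 1) → ℝ)) × (ℝ × ℝ)) × PairSkeleton m =>
        D q.1.2 q.2 := (hDc.comp (continuous_snd.comp continuous_fst)).clm_apply continuous_snd
    fun_prop
  have hcontf' : Continuous fun q : ((PhaseSpace (N + 1) × C(I, Fin (N + 1) → ℝ)) × (ℝ × ℝ)) × PairSkeleton m =>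
      f' q.1 q.2 := by
    have h1 : Continuous fun q : ((PhaseSpace (N + 1) × C(I, Fin (N + 1) → ℝ)) × (ℝ × ℝ)) × PairSkeleton m =>
        fderiv ℝ S (q.1.1.1, D q.1.2 q.2, q.1.1.2) :=
      (hdiff.continuous_fderiv one_ne_zero).comp hinner_c
    have h2 : Continuous fun q : ((PhaseSpace (N + 1) × C(I, Fin (N + 1) → ℝ)) × (ℝ × ℝ)) × PairSkeleton m =>
        ι.comp (D q.1.2) := continuous_const.clm_comp (hDc.comp (continuous_snd.comp continuous_fst))
    exact continuous_const.clm_comp (h1.clm_comp h2)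
  have hcontf : Continuous fun p : (PhaseSpace (N + 1) × C(I, Fin (N + 1) → ℝ)) × (ℝ × ℝ) => f p 0 := by
    have h0 : Continuous fun p : (PhaseSpace (N + 1) × C(I, Fin (N + 1) → ℝ)) × (ℝ × ℝ) =>
        (p.1.1, D p.2 0, p.1.2) := by
      have hDq : Continuous fun p : (PhaseSpace (N + 1) × C(I, Fin (N + 1) → ℝ)) × (ℝ × ℝ) => D p.2 0 :=
        (hDc.comp continuous_snd).clm_apply continuous_const
      fun_prop
    exact (ContinuousMap.evalCLM ℝ (1 : I)).continuous.comp (hdiff.continuous.comp h0)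
  set p₀ : (PhaseSpace (N + 1) × C(I, Fin (N + 1) → ℝ)) × (ℝ × ℝ) := ((0, 0), (a₀, b₀)) with hp₀
  have hD0 : ∀ q : ℝ × ℝ, D q 0 = 0 := fun q => map_zero _
  have hf00 : f p₀ 0 = 0 := by
    show S ((0 : PhaseSpace (N + 1)), D (a₀, b₀) 0, (0 : C(I, Fin (N + 1) → ℝ))) 1 = 0
    rw [hD0]
    have : ((0 : PhaseSpace (N + 1)), (0 : PairSkeleton m), (0 : C(I, Fin (N + 1) → ℝ))) = 0 := rfl
    rw [this, hS0]
    rfl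
  -- the amplitudes at `(a₀, b₀)` are invertible: the differential at `p₀` is onto
  have hc₁ : Real.sqrt (2 * γ * a₀) ≠ 0 := (Real.sqrt_pos.2 (by positivity)).ne'
  have hc₂ : Real.sqrt (2 * γ * b₀) ≠ 0 := (Real.sqrt_pos.2 (by positivity)).ne'
  have hsurj : LinearMap.range (f' p₀ 0 : PairSkeleton m →ₗ[ℝ] PhaseSpace (N + 1)) = ⊤ := by
    rw [LinearMap.range_eq_top]
    intro v
    obtain ⟨x, hx⟩ := LinearMap.range_eq_top.1 hsurjT v
    refine ⟨((Real.sqrt (2 * γ * a₀))⁻¹ • x.1, (Real.sqrt (2 * γ * b₀))⁻¹ • x.2), ?_⟩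
    have hDx : D (a₀, b₀) ((Real.sqrt (2 * γ * a₀))⁻¹ • x.1, (Real.sqrt (2 * γ * b₀))⁻¹ • x.2) = x := by
      rw [hD]
      simp [smul_smul, mul_inv_cancel₀ hc₁, mul_inv_cancel₀ hc₂]
    have : ((0 : PhaseSpace (N + 1)), (0 : PairSkeleton m), (0 : C(I, Fin (N + 1) → ℝ))) = 0 := rfl
    show (fderiv ℝ S ((0 : PhaseSpace (N + 1)), D (a₀, b₀) 0, (0 : C(I, Fin (N + 1) → ℝ)))
      (ι (D (a₀, b₀) ((Real.sqrt (2 * γ * a₀))⁻¹ • x.1, (Real.sqrt (2 * γ * b₀))⁻¹ • x.2)))) 1 = v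
    rw [hDx, hD0, this]
    exact hx
  -- nontriviality of the skeleton space
  haveI : Nontrivial (PairSkeleton m) := by
    refine ⟨⟨0, (fun _ => 1, 0), fun h => ?_⟩⟩
    have := congrArg (fun q : PairSkeleton m => q.1 ⟨0, Nat.two_pow_pos m⟩) h
    simp at this
  -- Haar instances on the skeleton space and on phase space
  haveI hpiS : (volume : Measure (Fin (2 ^ m) → ℝ)).IsAddHaarMeasure := isAddHaarMeasure_volume_pi _
  haveI hpiP : (volume : Measure (Fin (N + 1) → ℝ)).IsAddHaarMeasure := isAddHaarMeasure_volume_pi _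
  haveI hvolS : (volume : Measure (PairSkeleton m)).IsAddHaarMeasure :=
    Measure.prod.instIsAddHaarMeasure (volume : Measure (Fin (2 ^ m) → ℝ)) (volume : Measure (Fin (2 ^ m) → ℝ))
  haveI hvolP : (volume : Measure (PhaseSpace (N + 1))).IsAddHaarMeasure :=
    Measure.prod.instIsAddHaarMeasure (volume : Measure (Fin (N + 1) → ℝ)) (volume : Measure (Fin (N + 1) → ℝ))
  -- the submersion estimate, uniformly in `((z, ρ), (a, b))` near `((0, 0), (a₀, b₀))`
  obtain ⟨V, hV, ρ₀, hρ₀, r, hr, c, hc, hmin⟩ :=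
    exists_measure_preimage_ge_of_surjective (volume : Measure (PairSkeleton m))
      (volume : Measure (PhaseSpace (N + 1))) f f' (Eventually.of_forall fun q => hf' q.1 q.2)
      hcontf'.continuousAt hcontf.continuousAt hsurj
  rw [hf00] at hmin
  obtain ⟨ε₀, hε₀, hε₀V⟩ := Metric.mem_nhds_iff.1 hV
  set ε₁ : ℝ := min ε₀ 1 with hε₁
  have hε₁ : 0 < ε₁ := lt_min hε₀ one_pos
  have hε₁₀ : ε₁ ≤ ε₀ := min_le_left _ _
  have hε₁1 : ε₁ ≤ 1 := min_le_right _ _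
  -- the law of the skeleton dominates Lebesgue measure on the ball of radius `ρ₀`
  obtain ⟨c₂, hc₂, hskel⟩ := exists_wienerPair_map_pairSkel_ge m ρ₀
  -- bounds for the amplitudes near `(a₀, b₀)`
  set CL : ℝ := Real.sqrt (2 * γ * (a₀ + 1)) with hCL
  set CR : ℝ := Real.sqrt (2 * γ * (b₀ + 1)) with hCR
  have hCL0 : 0 ≤ CL := Real.sqrt_nonneg _
  have hCR0 : 0 ≤ CR := Real.sqrt_nonneg _
  have hamp : ∀ a a₁ : ℝ, |a - a₁| < ε₁ → |Real.sqrt (2 * γ * a)| ≤ Real.sqrt (2 * γ * (a₁ + 1)) := by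
    intro a a₁ ha
    rw [abs_of_nonneg (Real.sqrt_nonneg _)]
    refine Real.sqrt_le_sqrt ?_
    have : a ≤ a₁ + 1 := by linarith [(abs_lt.1 ha).2]
    nlinarith
  -- the good remainders
  have hCpos : 0 < (CL + CR + 1) * (1 + 2 * 2 ^ m) := by positivity
  set ε' : ℝ := ε₁ / 2 / ((CL + CR + 1) * (1 + 2 * 2 ^ m)) with hε'
  have hε'pos : 0 < ε' := by positivity
  have hε'bound : (CL + CR) * ((1 + 2 * 2 ^ m) * ε') < ε₁ := by
    have h1 : (CL + CR) * ((1 + 2 * 2 ^ m) * ε') ≤ (CL + CR + 1) * ((1 + 2 * 2 ^ m) * ε') :=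
      mul_le_mul_of_nonneg_right (by linarith) (by positivity)
    have h2 : (CL + CR + 1) * ((1 + 2 * 2 ^ m) * ε') = ε₁ / 2 := by
      rw [hε']; field_simp
    linarith
  -- the set of good remainder pairs (countably many conditions: measurable)
  set GoodR : Set WienerPair := {rr | (∀ n k : ℕ, ((k : ℝ≥0) / 2 ^ n ≤ 1) →
      |rr.1 ((k : ℝ≥0) / 2 ^ n)| ≤ (1 + 2 * 2 ^ m) * ε' ∧ |rr.2 ((k : ℝ≥0) / 2 ^ n)| ≤ (1 + 2 * 2 ^ m) * ε')}
    with hGoodR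
  have hGoodRm : MeasurableSet GoodR := by
    have : GoodR = ⋂ n : ℕ, ⋂ k : ℕ, {rr : WienerPair | ((k : ℝ≥0) / 2 ^ n ≤ 1) →
        |rr.1 ((k : ℝ≥0) / 2 ^ n)| ≤ (1 + 2 * 2 ^ m) * ε' ∧ |rr.2 ((k : ℝ≥0) / 2 ^ n)| ≤ (1 + 2 * 2 ^ m) * ε'} := by
      ext rr; simp [hGoodR]
    rw [this]
    refine MeasurableSet.iInter fun n => MeasurableSet.iInter fun k => ?_
    by_cases hkn : (k : ℝ≥0) / 2 ^ n ≤ 1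
    · simp only [hkn, forall_const]
      exact (measurableSet_le ((measurable_pi_apply _).comp measurable_fst).abs measurable_const).inter
        (measurableSet_le ((measurable_pi_apply _).comp measurable_snd).abs measurable_const)
    · simp [hkn]
  -- the good event of the Brownian pair forces a good remainder
  have hgood_sub : goodEvent ε' 1 ⊆ (pairRem m) ⁻¹' GoodR := by
    intro ω hω n k hk
    exact abs_pairRem_le_of_mem_goodEvent m hω hk
  have hgood_pos : 0 < wienerPair (goodEvent ε' 1) := wienerPair_goodEvent_pos hε'pos 1
  -- the constant
  refine ⟨ε₁, hε₁, r, hr, c₂ * c * wienerPair (goodEvent ε' 1),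
    ENNReal.mul_pos (ENNReal.mul_pos hc₂.ne' hc.ne').ne' hgood_pos.ne', fun a b ha hb z hz T hT hTm => ?_⟩
  -- the amplitudes and the skeleton objects at the temperatures `(a, b)`
  set cL : ℝ := Real.sqrt (2 * γ * a) with hcL
  set cR : ℝ := Real.sqrt (2 * γ * b) with hcR
  have hcLle : |cL| ≤ CL := hamp a a₀ ha
  have hcRle : |cR| ≤ CR := hamp b b₀ hb
  let ηab : PairSkeleton m → C(I, Fin (N + 1) → ℝ) → ℝ → Fin (N + 1) → ℝ := fun x ρ => η (D (a, b) x) ρ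
  have hηab : ∀ (x : PairSkeleton m) (ρ : C(I, Fin (N + 1) → ℝ)) (t : ℝ) (i : Fin (N + 1)),
      ηab x ρ t i = ρ (projIcc 0 1 zero_le_one t) i +
        ((if i.val = 0 then Real.sqrt (2 * γ * a) else 0) * plInterp m x.1 t.toNNReal +
          (if i.val = N + 1 - 1 then Real.sqrt (2 * γ * b) else 0) * plInterp m x.2 t.toNNReal) := by
    intro x ρ t i
    show η (D (a, b) x) ρ t i = _
    rw [hη, hD]
    simp only [plInterp_smul]
    split_ifs <;> ring
  let Sab : PhaseSpace (N + 1) × PairSkeleton m × C(I, Fin (N + 1) → ℝ) → C(I, PhaseSpace (N + 1)) :=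
    fun p => S (p.1, D (a, b) p.2.1, p.2.2)
  have hSab : ∀ p τ, Sab p τ = (pinnedChain ω₂ lam β γ).chainFlow (N + 1) p.1 (ηab p.2.1 p.2.2) τ :=
    fun p τ => hSapply _ τ
  -- the transition probability as a Wiener integral, factorised through the skeleton
  have hkernel : (pinnedChain ω₂ lam β γ).transitionKernel (N + 1) a b 1 z T =
      wienerPair ((fun ω => (pinnedChain ω₂ lam β γ).solMap (N + 1) a b 1 z (pairPath ω)) ⁻¹' T) := by
    have h := pinnedChain_transitionKernel_apply' hω hl.le hβ.le hγ.le (N + 1) a b 1 z hTm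
    simpa using h
  -- the integrand `G(x, rr) = 1_T(Φ_1(z, PL x + rr)) 1_{GoodR}(rr)`
  have h1m := pinnedChain_measurable_solMap hω hl.le hβ.le hγ.le (N + 1) a b (1 : ℝ)
  have h2m : Measurable fun q : PairSkeleton m × WienerPair => ((z : PhaseSpace (N + 1)), pairRecon m q.1 q.2) :=
    measurable_const.prodMk (measurable_pairRecon m)
  have hsolm : Measurable ((fun p : PhaseSpace (N + 1) × WienerPair =>
      (pinnedChain ω₂ lam β γ).solMap (N + 1) a b 1 p.1 p.2) ∘
      (fun q : PairSkeleton m × WienerPair => ((z : PhaseSpace (N + 1)), pairRecon m q.1 q.2))) :=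
    Measurable.comp h1m h2m
  let G : PairSkeleton m × WienerPair → ℝ≥0∞ := fun q =>
    ((T.indicator (1 : PhaseSpace (N + 1) → ℝ≥0∞)) ∘ ((fun p : PhaseSpace (N + 1) × WienerPair =>
      (pinnedChain ω₂ lam β γ).solMap (N + 1) a b 1 p.1 p.2) ∘
      (fun q : PairSkeleton m × WienerPair => ((z : PhaseSpace (N + 1)), pairRecon m q.1 q.2)))) q *
      GoodR.indicator 1 q.2
  have hGm : Measurable G :=
    ((measurable_one.indicator hTm).comp hsolm).mul ((measurable_one.indicator hGoodRm).comp measurable_snd)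
  -- `G(Ξ ω, R ω) ≤ 1_{Φ_1(z, B ω) ∈ T}`
  have hGle : ∀ ω, G (pairSkel m ω, pairRem m ω) ≤
      ((fun ω => (pinnedChain ω₂ lam β γ).solMap (N + 1) a b 1 z (pairPath ω)) ⁻¹' T).indicator 1 ω := by
    intro ω
    simp only [G, Function.comp_apply]
    rw [pairRecon_pairSkel_pairRem]
    by_cases hmem : (pinnedChain ω₂ lam β γ).solMap (N + 1) a b 1 z (pairPath ω) ∈ T
    · rw [indicator_of_mem hmem, indicator_of_mem (show ω ∈ (fun ω =>
        (pinnedChain ω₂ lam β γ).solMap (N + 1) a b 1 z (pairPath ω)) ⁻¹' T from hmem)]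
      simp only [Pi.one_apply, one_mul]
      exact indicator_le_self' (fun _ _ => zero_le_one) _
    · rw [indicator_of_notMem hmem, zero_mul]
      exact zero_le
  -- for a good remainder of the Brownian pair, the inner integral is at least `c₂ c Leb(T)`
  have hinner : ∀ ω, pairRem m ω ∈ GoodR →
      c₂ * c * volume T ≤ ∫⁻ x, G (x, pairRem m ω) ∂(wienerPair.map (pairSkel m)) := by
    intro ω hωR
    set rr := pairRem m ω with hrr
    have hr1 : Continuous rr.1 := continuous_pairRem_fst m ω
    have hr2 : Continuous rr.2 := continuous_pairRem_snd m ω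
    obtain ⟨hr10, hr20⟩ := pairRem_apply_zero m ω
    -- the remainder noise path and its smallness
    have hcI : Continuous fun τ : I => (⟨(τ : ℝ), τ.2.1⟩ : ℝ≥0) := continuous_subtype_val.subtype_mk _
    let ρr : C(I, Fin (N + 1) → ℝ) := ⟨fun τ i => (if i.val = 0 then cL else 0) * rr.1 ⟨(τ : ℝ), τ.2.1⟩ +
        (if i.val = N + 1 - 1 then cR else 0) * rr.2 ⟨(τ : ℝ), τ.2.1⟩, by
      refine continuous_pi fun i => ?_
      have h1 : Continuous fun τ : I => rr.1 ⟨(τ : ℝ), τ.2.1⟩ := hr1.comp hcI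
      have h2 : Continuous fun τ : I => rr.2 ⟨(τ : ℝ), τ.2.1⟩ := hr2.comp hcI
      fun_prop⟩
    have hρr : ∀ (τ : I) (i : Fin (N + 1)), ρr τ i = (if i.val = 0 then cL else 0) * rr.1 ⟨(τ : ℝ), τ.2.1⟩ +
        (if i.val = N + 1 - 1 then cR else 0) * rr.2 ⟨(τ : ℝ), τ.2.1⟩ := fun τ i => rfl
    have hsmall : ∀ u : ℝ≥0, u ≤ 1 → |rr.1 u| ≤ (1 + 2 * 2 ^ m) * ε' ∧ |rr.2 u| ≤ (1 + 2 * 2 ^ m) * ε' := by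
      intro u hu
      exact ⟨abs_le_of_dyadic hr1 (fun n k hk => (hωR n k hk).1) hu,
        abs_le_of_dyadic hr2 (fun n k hk => (hωR n k hk).2) hu⟩
    have hρnorm : ‖ρr‖ < ε₁ := by
      refine (ContinuousMap.norm_lt_iff _ hε₁).2 fun τ => ?_
      refine (pi_norm_le_iff_of_nonneg (by positivity)).2 (fun i => ?_) |>.trans_lt hε'bound
      rw [Real.norm_eq_abs, hρr]
      obtain ⟨h1, h2⟩ := hsmall ⟨(τ : ℝ), τ.2.1⟩ (by exact_mod_cast τ.2.2)
      have hL' : |(if i.val = 0 then cL else 0) * rr.1 ⟨(τ : ℝ), τ.2.1⟩| ≤ CL * ((1 + 2 * 2 ^ m) * ε') := by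
        rw [abs_mul]
        refine mul_le_mul ?_ h1 (abs_nonneg _) hCL0
        split_ifs <;> simp [hcLle, hCL0]
      have hR' : |(if i.val = N + 1 - 1 then cR else 0) * rr.2 ⟨(τ : ℝ), τ.2.1⟩| ≤ CR * ((1 + 2 * 2 ^ m) * ε') := by
        rw [abs_mul]
        refine mul_le_mul ?_ h2 (abs_nonneg _) hCR0
        split_ifs <;> simp [hcRle, hCR0]
      calc _ ≤ |(if i.val = 0 then cL else 0) * rr.1 ⟨(τ : ℝ), τ.2.1⟩| +
            |(if i.val = N + 1 - 1 then cR else 0) * rr.2 ⟨(τ : ℝ), τ.2.1⟩| := abs_add_le _ _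
        _ ≤ CL * ((1 + 2 * 2 ^ m) * ε') + CR * ((1 + 2 * 2 ^ m) * ε') := add_le_add hL' hR'
        _ = (CL + CR) * ((1 + 2 * 2 ^ m) * ε') := by ring
    -- `((z, ρr), (a, b)) ∈ V`
    have hzρ : (((z, ρr), (a, b)) : (PhaseSpace (N + 1) × C(I, Fin (N + 1) → ℝ)) × (ℝ × ℝ)) ∈ V := by
      refine hε₀V (mem_ball.2 ?_)
      have h1 : dist ((z, ρr) : PhaseSpace (N + 1) × C(I, Fin (N + 1) → ℝ)) (0, 0) < ε₀ :=
        calc dist ((z, ρr) : PhaseSpace (N + 1) × C(I, Fin (N + 1) → ℝ)) (0, 0) = max (dist z 0) (dist ρr 0) :=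
              Prod.dist_eq
          _ < ε₀ := by
              rw [dist_zero_right, dist_zero_right]
              exact max_lt (hz.trans_le hε₁₀) (hρnorm.trans_le hε₁₀)
      have h2 : dist ((a, b) : ℝ × ℝ) (a₀, b₀) < ε₀ :=
        calc dist ((a, b) : ℝ × ℝ) (a₀, b₀) = max (dist a a₀) (dist b b₀) := Prod.dist_eq
          _ < ε₀ := by
              rw [Real.dist_eq, Real.dist_eq]
              exact max_lt (ha.trans_le hε₁₀) (hb.trans_le hε₁₀)
      calc dist (((z, ρr), (a, b)) : (PhaseSpace (N + 1) × C(I, Fin (N + 1) → ℝ)) × (ℝ × ℝ)) p₀ =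
            max (dist ((z, ρr) : PhaseSpace (N + 1) × C(I, Fin (N + 1) → ℝ)) (0, 0))
              (dist ((a, b) : ℝ × ℝ) (a₀, b₀)) := Prod.dist_eq
        _ < ε₀ := max_lt h1 h2
    -- the inner integrand is the indicator of `{x | f ((z, ρr), (a, b)) x ∈ T}`
    have hGeq : ∀ x, G (x, rr) = ((f ((z, ρr), (a, b))) ⁻¹' T).indicator 1 x := by
      intro x
      simp only [G, Function.comp_apply]
      rw [indicator_of_mem hωR, Pi.one_apply, mul_one,
        solMap_one_pairRecon_eq_skelSol hω hl.le hβ.le hγ.le a b m ηab hηab hSab x hr1 hr2 hr10 hr20 ρr hρr z]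
      rfl
    simp_rw [hGeq]
    have hfTm : MeasurableSet ((f ((z, ρr), (a, b))) ⁻¹' T) :=
      ((hf' ((z, ρr), (a, b)) ·) |> fun h => (continuous_iff_continuousAt.2 fun x => (h x).continuousAt)).measurable hTm
    rw [lintegral_indicator_one hfTm]
    calc c₂ * c * volume T = c₂ * (c * volume T) := mul_assoc _ _ _
      _ ≤ c₂ * volume (closedBall (0 : PairSkeleton m) ρ₀ ∩ f ((z, ρr), (a, b)) ⁻¹' T) :=
          mul_le_mul' le_rfl (hmin ((z, ρr), (a, b)) hzρ T hT hTm)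
      _ ≤ wienerPair.map (pairSkel m) (closedBall (0 : PairSkeleton m) ρ₀ ∩ f ((z, ρr), (a, b)) ⁻¹' T) :=
          hskel _ inter_subset_left (measurableSet_closedBall.inter hfTm)
      _ ≤ wienerPair.map (pairSkel m) (f ((z, ρr), (a, b)) ⁻¹' T) := measure_mono inter_subset_right
  -- assemble: Wiener integral ≥ factorised integral ≥ good part
  rw [hkernel, ← lintegral_indicator_one ((hTm.preimage
    (pinnedChain_measurable_solMap_pairPath_right hω hl.le hβ.le hγ.le (N + 1) a b 1 z)))]
  calc c₂ * c * wienerPair (goodEvent ε' 1) * volume T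
      = c₂ * c * volume T * wienerPair (goodEvent ε' 1) := by ring
    _ ≤ c₂ * c * volume T * wienerPair ((pairRem m) ⁻¹' GoodR) := by
        gcongr
    _ = ∫⁻ ω, ((pairRem m) ⁻¹' GoodR).indicator (fun _ => c₂ * c * volume T) ω ∂wienerPair := by
        rw [lintegral_indicator_const (hGoodRm.preimage (measurable_pairRem m))]
    _ ≤ ∫⁻ ω, ∫⁻ x, G (x, pairRem m ω) ∂(wienerPair.map (pairSkel m)) ∂wienerPair := by
        refine lintegral_mono fun ω => ?_
        by_cases hωR : pairRem m ω ∈ GoodR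
        · rw [indicator_of_mem (show ω ∈ (pairRem m) ⁻¹' GoodR from hωR)]
          exact hinner ω hωR
        · rw [indicator_of_notMem (show ω ∉ (pairRem m) ⁻¹' GoodR from hωR)]
          exact zero_le
    _ = ∫⁻ ω, G (pairSkel m ω, pairRem m ω) ∂wienerPair := (lintegral_pairSkel_pairRem m hGm).symm
    _ ≤ ∫⁻ ω, ((fun ω => (pinnedChain ω₂ lam β γ).solMap (N + 1) a b 1 z (pairPath ω)) ⁻¹' T).indicator 1 ω
          ∂wienerPair := lintegral_mono hGle

end Summit.AtomisticToContinuum.FouriersLaw.Theorems.BoundaryKubo.GibbsTtcf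

end
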